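import Summits.Ventures.CertifiedArithmetic.LowPrec.GemmThetaE2M3Check01
import Summits.Ventures.CertifiedArithmetic.LowPrec.GemmThetaE2M3Check02
import Summits.Ventures.CertifiedArithmetic.LowPrec.GemmThetaE2M3Check03
import Summits.Ventures.CertifiedArithmetic.LowPrec.GemmThetaE2M3Check04
import Summits.Ventures.CertifiedArithmetic.LowPrec.GemmThetaE2M3Check05
import Summits.Ventures.CertifiedArithmetic.LowPrec.GemmThetaE2M3Check06
import Summits.Ventures.CertifiedArithmetic.LowPrec.GemmThetaE2M3Check07
import Summits.Ventures.CertifiedArithmetic.LowPrec.GemmThetaE2M3Check08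
import Summits.Ventures.CertifiedArithmetic.LowPrec.GemmThetaE2M3Check09
import Summits.Ventures.CertifiedArithmetic.LowPrec.GemmThetaE2M3Check10
import Summits.Ventures.CertifiedArithmetic.LowPrec.GemmThetaE2M3Check11
import Summits.Ventures.CertifiedArithmetic.LowPrec.GemmThetaE2M3Check12
import Summits.Ventures.CertifiedArithmetic.LowPrec.GemmThetaE2M3Check13
import Summits.Ventures.CertifiedArithmetic.LowPrec.GemmThetaE2M3Check14
import Summits.Ventures.CertifiedArithmetic.LowPrec.GemmThetaE2M3Check15
import Summits.Ventures.CertifiedArithmetic.LowPrec.GemmThetaE2M3Check16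
import Summits.Ventures.CertifiedArithmetic.LowPrec.GemmThetaE2M3Check17
import Summits.Ventures.CertifiedArithmetic.LowPrec.GemmThetaE2M3Check18
import Summits.Ventures.CertifiedArithmetic.LowPrec.GemmThetaE2M3Check19
import Summits.Ventures.CertifiedArithmetic.LowPrec.GemmThetaE2M3Check20
import Summits.Ventures.CertifiedArithmetic.LowPrec.GemmThetaE2M3Check21
import Summits.Ventures.CertifiedArithmetic.LowPrec.GemmThetaE2M3Check22
import Summits.Ventures.CertifiedArithmetic.LowPrec.GemmThetaE2M3Check23
import Summits.Ventures.CertifiedArithmetic.LowPrec.GemmThetaE2M3Check24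
import Summits.Ventures.CertifiedArithmetic.LowPrec.GemmThetaE2M3Check25
import Summits.Ventures.CertifiedArithmetic.LowPrec.GemmThetaE2M3Check26
import Summits.Ventures.CertifiedArithmetic.LowPrec.GemmThetaE2M3Check27
import Summits.Ventures.CertifiedArithmetic.LowPrec.GemmThetaE2M3Check28
import Summits.Ventures.CertifiedArithmetic.LowPrec.GemmThetaE2M3Check29
import Summits.Ventures.CertifiedArithmetic.LowPrec.GemmTerminalConstant

/-!
# The θ-certificate of E2M3²→bfloat16 assembled: `thetaCert_E2M3_BFloat16`

HONEST FRAMING (venture CertifiedArithmetic / cell `pub-lowprec`, seat gemm, gen 7): certified error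
envelopes and provably optimal rounding/accumulation schemes for low-precision formats under stated
cost models; every table by two implementations; no hardware or vendor claims.

Paper `gemm.tex` §Regimes, Prop. "the terminal constant bounds the defect for every n" (i), instance
E2M3·E2M3 products (FP6, [RouhaniEtAl2023MX]) accumulated sequentially in `bfloat16` under
round-to-nearest-even (the cell's model `seqSum`).  The kernel-checked Boolean certificate of
`GemmThetaE2M3Defs.lean` / `GemmThetaE2M3Check01…29.lean` (2 · 1793 states × 443 letters =
1,588,598 edges, closed-form potential `Φ`, constants `θ = 18/7`, `ρ = 63/2`, `β_pair = 191/2`,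
`κ = 32/97`) is turned into a `ThetaCertificate` (`thetaCert_E2M3_BFloat16`) for the letter
predicate `· ∈ piE2M3` (`piE2M3 = lamG / 2^6`) through the dyadic bridge `flStep_dyadic`
(`GemmDyadicStep.lean`), so that the generic soundness theorem `ThetaCertificate.defect_bound` gives
`1746/(679n + 168386) ≤ 1 - (ŝ - Σ x)/Σ|x|` for every input — `GemmThetaE2M3Bound.lean` states it
for E2M3 data and sandwiches `W(n)` with the tie-chain lower bound of `GemmTerminalE2M3.lean`.
-/

namespace Literature.ComputerArithmetic.FloatingPoint

namespace MiniFloat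

open Finset ThetaE2M3

namespace ThetaE2M3

/-! ### Sizes and casts -/

/-- Every state magnitude is at most `2^20` grid units (`v ≤ 2^14`). [cell] -/
theorem valG_le (i : ℕ) : valG i ≤ 1048576 := by
  unfold valG
  split_ifs with h1 h2
  · omega
  · have he : (i - 256) / 128 + 1 ≤ 12 := by omega
    calc (128 + (i - 256) % 128) * 2 ^ ((i - 256) / 128 + 1) ≤ 255 * 2 ^ 12 :=
          Nat.mul_le_mul (by omega) (Nat.pow_le_pow_right (by norm_num) he)
      _ ≤ 1048576 := by norm_num
  · exact le_rfl

/-- `|sval σ i| ≤ 2^20`. [cell] -/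
theorem natAbs_sval_le (σ : Bool) (i : ℕ) : (sval σ i).natAbs ≤ 1048576 := by
  refine le_trans (le_of_eq ?_) (valG_le i)
  unfold sval; split <;> simp

/-- Letters have magnitude at most `3600 = 60²`. [cell] -/
theorem natAbs_le_of_mem_lamG {Q : ℤ} (hQ : Q ∈ lamG) : Q.natAbs ≤ 3600 :=
  lamG_natAbs_le Q hQ

/-- The bridge applies to every edge: `|V + Q| < 2^32`. [cell] -/
theorem natAbs_add_lt {V Q : ℤ} (hV : V.natAbs ≤ 1048576) (hQ : Q.natAbs ≤ 3600) :
    (V + Q).natAbs < 2 ^ 32 := by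
  have : (V + Q).natAbs ≤ V.natAbs + Q.natAbs := Int.natAbs_add_le V Q
  norm_num; omega

/-- `6 ≤ 133`: the grid `2^-6` is within `bfloat16`'s exponent range. [folklore] -/
theorem g6 : (6 : ℕ) ≤ 133 := by norm_num

/-! ### The dictionary in grid units `2^-6` -/

/-- THE POTENTIAL as a function on `ℚ`: `Φ(v) = psiZ(2^6 v)/2^6`. [cell, gemm.tex §Regimes] -/
def psiG (v : ℚ) : ℚ := (psiZ ⌊v * 2 ^ 6⌋ : ℚ) / 2 ^ 6

/-- `Φ(V/2^6) = psiZ V / 2^6`. [cell] -/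
theorem psiG_dyadic (V : ℤ) : psiG ((V : ℚ) / 2 ^ 6) = (psiZ V : ℚ) / 2 ^ 6 := by
  unfold psiG; rw [div_mul_cancel₀ (V : ℚ) (by norm_num : (2 : ℚ) ^ 6 ≠ 0), Int.floor_intCast]

/-- THE STATE SET: `± valG i / 2^6`, `i < 1793`. [cell, gemm.tex §Regimes] -/
def SG (v : ℚ) : Prop := ∃ σ : Bool, ∃ i : ℕ, i < 1793 ∧ v = (sval σ i : ℚ) / 2 ^ 6

/-- A magnitude recognised by the closure check is a state. [cell] -/
theorem SG_of_idx {W : ℤ} (h1 : idxG W.natAbs < 1793) (h2 : valG (idxG W.natAbs) = W.natAbs) :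
    SG ((W : ℚ) / 2 ^ 6) := by
  refine ⟨decide (W < 0), idxG W.natAbs, h1, ?_⟩
  have : sval (decide (W < 0)) (idxG W.natAbs) = W := by
    unfold sval; rw [h2]
    by_cases hW : W < 0
    · simp only [hW, decide_true, if_true]; omega
    · simp only [hW, decide_false, Bool.false_eq_true, if_false]; omega
  rw [this]

/-! ### From the chunked Boolean theorems to one statement per edge -/

/-- THE WHOLE TABLE: every edge of the graph passes `edgeOK` (the 29 kernel-checked parts
concatenated). [cell certificate, kernel-checked in Check01…29] -/
theorem all_ok : rowsOK 0 1793 = true :=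
  rowsOK_append (l₁ := 64) (l₂ := 1729) rfl part_01 <|
  rowsOK_append (l₁ := 64) (l₂ := 1665) rfl part_02 <|
  rowsOK_append (l₁ := 64) (l₂ := 1601) rfl part_03 <|
  rowsOK_append (l₁ := 64) (l₂ := 1537) rfl part_04 <|
  rowsOK_append (l₁ := 64) (l₂ := 1473) rfl part_05 <|
  rowsOK_append (l₁ := 64) (l₂ := 1409) rfl part_06 <|
  rowsOK_append (l₁ := 64) (l₂ := 1345) rfl part_07 <|
  rowsOK_append (l₁ := 64) (l₂ := 1281) rfl part_08 <|
  rowsOK_append (l₁ := 64) (l₂ := 1217) rfl part_09 <|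
  rowsOK_append (l₁ := 64) (l₂ := 1153) rfl part_10 <|
  rowsOK_append (l₁ := 64) (l₂ := 1089) rfl part_11 <|
  rowsOK_append (l₁ := 64) (l₂ := 1025) rfl part_12 <|
  rowsOK_append (l₁ := 64) (l₂ := 961) rfl part_13 <|
  rowsOK_append (l₁ := 64) (l₂ := 897) rfl part_14 <|
  rowsOK_append (l₁ := 64) (l₂ := 833) rfl part_15 <|
  rowsOK_append (l₁ := 64) (l₂ := 769) rfl part_16 <|
  rowsOK_append (l₁ := 64) (l₂ := 705) rfl part_17 <|
  rowsOK_append (l₁ := 64) (l₂ := 641) rfl part_18 <|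
  rowsOK_append (l₁ := 64) (l₂ := 577) rfl part_19 <|
  rowsOK_append (l₁ := 64) (l₂ := 513) rfl part_20 <|
  rowsOK_append (l₁ := 64) (l₂ := 449) rfl part_21 <|
  rowsOK_append (l₁ := 64) (l₂ := 385) rfl part_22 <|
  rowsOK_append (l₁ := 64) (l₂ := 321) rfl part_23 <|
  rowsOK_append (l₁ := 64) (l₂ := 257) rfl part_24 <|
  rowsOK_append (l₁ := 64) (l₂ := 193) rfl part_25 <|
  rowsOK_append (l₁ := 64) (l₂ := 129) rfl part_26 <|
  rowsOK_append (l₁ := 64) (l₂ := 65) rfl part_27 <|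
  rowsOK_append (l₁ := 64) (l₂ := 1) rfl part_28 <|
  part_29

/-- Every edge of the graph passes `edgeOK`. [cell certificate, kernel-checked] -/
theorem edge_ok (σ : Bool) {i : ℕ} (hi : i < 1793) {Q : ℤ} (hQ : Q ∈ lamG) :
    edgeOK σ i Q = true := by
  have h := all_ok
  unfold rowsOK at h
  have h1 := List.all_eq_true.mp h i (List.mem_range'_1.mpr ⟨Nat.zero_le _, by omega⟩)
  have h2 := List.all_eq_true.mp h1 Q hQ
  rw [Bool.and_eq_true] at h2
  cases σ
  · exact h2.1
  · exact h2.2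

/-- What `edgeOK = true` says, as propositions. [cell] -/
theorem edgeOK_cases {σ : Bool} {i : ℕ} {Q : ℤ} (h : edgeOK σ i Q = true) :
    (WQ σ i Q = sval σ i ∧ (0 ≤ Q ∨ 18 * -Q ≤ 7 * psiZ (sval σ i))) ∨
    (WQ σ i Q ≠ sval σ i ∧ idxG (WQ σ i Q).natAbs < 1793 ∧
      valG (idxG (WQ σ i Q).natAbs) = (WQ σ i Q).natAbs ∧
      psiZ (WQ σ i Q) ≤ psiZ (sval σ i) + defQ σ i Q ∧
      ((0 < defQ σ i Q ∧ 2 * gainQ σ i Q ≤ 63 * defQ σ i Q) ∨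
       (¬ 0 < defQ σ i Q ∧ 97 * gainQ σ i Q ≤ 32 * psiZ (sval σ i) ∧
          pairOK (WQ σ i Q) (gainQ σ i Q) = true))) := by
  unfold edgeOK at h
  split_ifs at h with hWV hd
  · simp only [Bool.or_eq_true, decide_eq_true_eq] at h
    exact Or.inl ⟨hWV, h⟩
  · simp only [Bool.and_eq_true, decide_eq_true_eq] at h
    exact Or.inr ⟨hWV, h.1.1.1, h.1.1.2, h.1.2, Or.inl ⟨hd, h.2⟩⟩
  · simp only [Bool.and_eq_true, decide_eq_true_eq] at h
    exact Or.inr ⟨hWV, h.1.1.1, h.1.1.2, h.1.2, Or.inr ⟨hd, h.2.1, h.2.2⟩⟩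

/-- What `pairOK = true` says for one letter. [cell] -/
theorem pairOK_sound {W δf Q' : ℤ} (h : pairOK W δf = true) (hQ' : Q' ∈ lamG) :
    rne8 (W + Q') = W ∨
      2 * (δf + (rne8 (W + Q') - W - Q')) ≤ 191 * ((Q'.natAbs : ℤ) - (rne8 (W + Q') - W - Q')) := by
  have h1 := List.all_eq_true.mp h Q' hQ'
  simp only [Bool.or_eq_true, decide_eq_true_eq] at h1
  exact h1

end ThetaE2M3

/-! ### The letters as rationals -/

/-- THE ALPHABET `Π(E2M3, E2M3)`: the 443 products `a · b` of E2M3 data, `= lamG / 2^6`.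
[cell, gemm.tex §Regimes; RouhaniEtAl2023MX Table 1 for the value set] -/
def piE2M3 : List ℚ := lamG.map fun Q : ℤ => (Q : ℚ) / 2 ^ 6

/-- Every letter of `piE2M3` is `Q/2^6` with `Q ∈ lamG`. [cell] -/
theorem exists_of_mem_piE2M3 {q : ℚ} (hq : q ∈ piE2M3) : ∃ Q ∈ lamG, (Q : ℚ) / 2 ^ 6 = q :=
  List.mem_map.mp hq

/-! ### The certificate -/

/-- THE θ-CERTIFICATE OF E2M3²→bfloat16 (RNE, sequential): letters `piE2M3`, states `SG`, potential
`psiG`, `θ = 18/7`, `ρ = 63/2`, `β_pair = 191/2`, `κ = 32/97`. [cell certificate, kernel-checked] -/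
theorem thetaCert_E2M3_BFloat16 :
    ThetaCertificate Format.BFloat16 (fun q => q ∈ piE2M3) SG psiG
      (18 / 7) (63 / 2) (191 / 2) (32 / 97) where
  θ_pos := by norm_num
  ρ_nonneg := by norm_num
  βp_nonneg := by norm_num
  κ_nonneg := by norm_num
  start := by
    intro q hq
    obtain ⟨Q, hQ, rfl⟩ := exists_of_mem_piE2M3 hq
    have hb : Q.natAbs < 2 ^ 32 := by have := natAbs_le_of_mem_lamG hQ; norm_num; omega
    have hs := starts_ok Q hQ
    unfold startOK at hs
    simp only [Bool.and_eq_true, decide_eq_true_eq] at hs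
    obtain ⟨⟨⟨h0, h1⟩, h2⟩, h3⟩ := hs
    refine ⟨?_, SG_of_idx h1 h2, ?_⟩
    · obtain ⟨y, hy⟩ := exists_toRat_eq_rneQuarter_dyadic g6 Q hb
      exact ⟨y, by rw [hy, ← rne8_eq_rneQuarter hb, h0]⟩
    · rw [psiG_dyadic, abs_div, abs_of_pos (by positivity : (0 : ℚ) < 2 ^ 6), ← Int.cast_abs,
        ← Int.natCast_natAbs]
      have : ((psiZ Q : ℤ) : ℚ) ≤ ((Q.natAbs : ℤ) : ℚ) := by exact_mod_cast h3
      exact div_le_div_of_nonneg_right (by exact_mod_cast this) (by positivity)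
  closed := by
    rintro v q ⟨σ, i, hi, rfl⟩ hq
    obtain ⟨Q, hQ, rfl⟩ := exists_of_mem_piE2M3 hq
    have hb := natAbs_add_lt (natAbs_sval_le σ i) (natAbs_le_of_mem_lamG hQ)
    rw [flStep_dyadic g6 hb]
    rcases edgeOK_cases (edge_ok σ hi hQ) with ⟨hWV, -⟩ | ⟨-, h1, h2, -, -⟩
    · unfold WQ at hWV; rw [hWV]; exact ⟨σ, i, hi, rfl⟩
    · exact SG_of_idx h1 h2
  potential := by
    rintro v q ⟨σ, i, hi, rfl⟩ hq hne
    obtain ⟨Q, hQ, rfl⟩ := exists_of_mem_piE2M3 hq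
    have hb := natAbs_add_lt (natAbs_sval_le σ i) (natAbs_le_of_mem_lamG hQ)
    rw [flStep_dyadic g6 hb] at hne ⊢
    rw [psiG_dyadic, psiG_dyadic, deficitOf_dyadic g6 hb]
    rcases edgeOK_cases (edge_ok σ hi hQ) with ⟨hWV, -⟩ | ⟨-, -, -, h3, -⟩
    · unfold WQ at hWV; exact absurd (dyadic_eq_iff.mpr hWV) hne
    · unfold defQ gainQ WQ at h3
      have h3' : ((psiZ (rne8 (sval σ i + Q)) : ℤ) : ℚ)
          ≤ ((psiZ (sval σ i) + ((Q.natAbs : ℤ) - (rne8 (sval σ i + Q) - sval σ i - Q)) : ℤ) : ℚ) := by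
        exact_mod_cast h3
      push_cast at h3' ⊢
      linarith
  capacity := by
    rintro v q ⟨σ, i, hi, rfl⟩ hq habs hneg
    obtain ⟨Q, hQ, rfl⟩ := exists_of_mem_piE2M3 hq
    have hb := natAbs_add_lt (natAbs_sval_le σ i) (natAbs_le_of_mem_lamG hQ)
    rw [flStep_dyadic g6 hb, dyadic_eq_iff] at habs
    have hQ0 : Q < 0 := by
      have : (Q : ℚ) < 0 := by
        have h2 : (0 : ℚ) < 2 ^ 6 := by positivity
        by_contra hc; push Not at hc
        exact absurd hneg (not_lt.mpr (div_nonneg hc h2.le))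
      exact_mod_cast this
    rw [psiG_dyadic]
    rcases edgeOK_cases (edge_ok σ hi hQ) with ⟨-, hcap⟩ | ⟨hWV, -⟩
    · rcases hcap with h | h
      · omega
      · have h' : ((18 * -Q : ℤ) : ℚ) ≤ ((7 * psiZ (sval σ i) : ℤ) : ℚ) := by exact_mod_cast h
        push_cast at h'
        rw [show (18 : ℚ) / 7 * -((Q : ℚ) / 2 ^ 6) = 18 * -(Q : ℚ) / 7 / 2 ^ 6 by ring]
        exact div_le_div_of_nonneg_right (by linarith) (by positivity)
    · exact absurd habs hWV
  paid := by
    rintro v q ⟨σ, i, hi, rfl⟩ hq hne hpos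
    obtain ⟨Q, hQ, rfl⟩ := exists_of_mem_piE2M3 hq
    have hb := natAbs_add_lt (natAbs_sval_le σ i) (natAbs_le_of_mem_lamG hQ)
    rw [flStep_dyadic g6 hb] at hne
    rw [deficitOf_dyadic g6 hb] at hpos ⊢
    rw [gainOf_dyadic g6 hb]
    have hpos' : (0 : ℤ) < (Q.natAbs : ℤ) - (rne8 (sval σ i + Q) - sval σ i - Q) := by
      have : (0 : ℚ) < (((Q.natAbs : ℤ) - (rne8 (sval σ i + Q) - sval σ i - Q) : ℤ) : ℚ) := by
        have h2 : (0 : ℚ) < 2 ^ 6 := by positivity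
        by_contra hc; push Not at hc
        exact absurd hpos (not_lt.mpr (div_nonpos_of_nonpos_of_nonneg hc h2.le))
      exact_mod_cast this
    rcases edgeOK_cases (edge_ok σ hi hQ) with ⟨hWV, -⟩ | ⟨-, -, -, -, hmv⟩
    · unfold WQ at hWV; exact absurd (dyadic_eq_iff.mpr hWV) hne
    · rcases hmv with ⟨-, h⟩ | ⟨hd, -, -⟩
      · unfold defQ gainQ WQ at h
        have h' : ((2 * (rne8 (sval σ i + Q) - sval σ i - Q) : ℤ) : ℚ)
            ≤ ((63 * ((Q.natAbs : ℤ) - (rne8 (sval σ i + Q) - sval σ i - Q)) : ℤ) : ℚ) := by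
          exact_mod_cast h
        push_cast at h' ⊢
        rw [← mul_div_assoc, div_le_div_iff_of_pos_right (by positivity : (0 : ℚ) < 2 ^ 6)]
        linarith
      · unfold defQ gainQ WQ at hd; exact absurd hpos' hd
  free := by
    rintro v q ⟨σ, i, hi, rfl⟩ hq hne hd0
    obtain ⟨Q, hQ, rfl⟩ := exists_of_mem_piE2M3 hq
    have hb := natAbs_add_lt (natAbs_sval_le σ i) (natAbs_le_of_mem_lamG hQ)
    have h28 : (0 : ℚ) < 2 ^ 6 := by positivity
    rw [flStep_dyadic g6 hb] at hne ⊢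
    rw [deficitOf_dyadic g6 hb] at hd0
    rw [gainOf_dyadic g6 hb, psiG_dyadic]
    have hd0' : (Q.natAbs : ℤ) - (rne8 (sval σ i + Q) - sval σ i - Q) = 0 := by
      have : ((((Q.natAbs : ℤ) - (rne8 (sval σ i + Q) - sval σ i - Q)) : ℤ) : ℚ) = 0 := by
        rcases div_eq_zero_iff.mp hd0 with h | h
        · exact h
        · exact absurd h (ne_of_gt h28)
      exact_mod_cast this
    rcases edgeOK_cases (edge_ok σ hi hQ) with ⟨hWV, -⟩ | ⟨-, h1, h2, -, hmv⟩
    · unfold WQ at hWV; exact absurd (dyadic_eq_iff.mpr hWV) hne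
    rcases hmv with ⟨hd, -⟩ | ⟨-, hκ, hpair⟩
    · unfold defQ gainQ WQ at hd; omega
    unfold gainQ WQ at hκ hpair
    refine ⟨?_, ?_⟩
    · have h' : ((97 * (rne8 (sval σ i + Q) - sval σ i - Q) : ℤ) : ℚ)
          ≤ ((32 * psiZ (sval σ i) : ℤ) : ℚ) := by exact_mod_cast hκ
      push_cast at h' ⊢
      rw [← mul_div_assoc, div_le_div_iff_of_pos_right h28]
      linarith
    · intro q' hq' hne'
      obtain ⟨Q', hQ', rfl⟩ := exists_of_mem_piE2M3 hq'
      have hW : (rne8 (sval σ i + Q)).natAbs ≤ 1048576 := by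
        unfold WQ at h2; rw [← h2]; exact valG_le _
      have hb' := natAbs_add_lt hW (natAbs_le_of_mem_lamG hQ')
      rw [flStep_dyadic g6 hb'] at hne'
      rw [gainOf_dyadic g6 hb', deficitOf_dyadic g6 hb']
      rcases pairOK_sound hpair hQ' with h | h
      · exact absurd (by rw [h]) hne'
      · have h' : ((2 * ((rne8 (sval σ i + Q) - sval σ i - Q)
              + (rne8 (rne8 (sval σ i + Q) + Q') - rne8 (sval σ i + Q) - Q')) : ℤ) : ℚ)
            ≤ ((191 * ((Q'.natAbs : ℤ) - (rne8 (rne8 (sval σ i + Q) + Q')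
              - rne8 (sval σ i + Q) - Q')) : ℤ) : ℚ) := by
          exact_mod_cast h
        push_cast at h' ⊢
        rw [← add_div, ← mul_div_assoc, div_le_div_iff_of_pos_right h28]
        linarith

end MiniFloat

end Literature.ComputerArithmetic.FloatingPoint
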